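import Literature.Geometry.Kaehler.ComplexTorusMixedHodgeIndexAllBidegrees
import HarnessLib

/-!
# The kernel of the mixed Hodge–Riemann form on `Λ^{p,q}` for an ARBITRARY real `(1,1)` background, and the
# Hodge–Riemann cone in every bidegree (Dinh–Nguyên's Prop. 4.1 on a complex torus)

Layer `Literature/Geometry/Kaehler`, namespace `Literature.Geometry.Kaehler.ComplexTorus`; lane `lit-hodgefound`
(Track 2, HodgeConjecture), seat p16, generation 25 (row g25-#3); sequel of g25-#1 `ComplexTorusMixedHodgeIndexAllBidegrees`
(the mixed Hodge index theorem in every bidegree and the closure of the cone) and of the degree-two files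
`ComplexTorusMixedHodgeIndexSemipositiveKernel` / `…Signature` (Dinh–Nguyên's Prop. 4.1 on `H²`). Everything here is
PROVED: theorems only, no definition, no named fact (net debt 0).

Dinh–Nguyên's §4 describes, for `p = q = 1` on a compact Kähler manifold, "the domain of validity of the mixed
Hodge–Riemann theorem": the cone `K^{HR}` of classes `[Ω]` for which `Q` is positive definite on `P^{1,1}` "is a union of
connected components of `K_{n-2} ∖ L_{n-2}`" where `L` is the algebraic cone where "`[α] ↦ [α] ∧ [Ω]` does not induce an
isomorphism", and on `K̄^{HR}` "`Q(·,·)` is positive semi-definite on `P^{1,1}(X)` and for `c ∈ P^{1,1}(X)` we have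
`Q(c, c) = 0` if and only if `c ∧ [Ω] = 0`" — the proof being "`Q(c, ·) = 0`. Therefore, the Poincaré duality implies
that `c ∧ [Ω] = 0`". On a complex torus `X = E/Φ(ℤ^ι)` (constant forms = cohomology) we prove the corresponding
statements in EVERY bidegree `(p, q)`, for the real mixed Hodge–Riemann form
`h_Θ(A, B) = Re(ε ∫_X Ω_Θ ∧ A ∧ B̄)` on `Λ^{p,q}` (T4a `hrFormPQ`; `Ω_Θ = θ_1 ∧ ⋯ ∧ θ_n`, `dim X = n + p + q`):

* §1–§2 (ANY real background of type `(1,1)`, positive or not): the radical of `h_Θ` on `Λ^{p,q}` is EXACTLY the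
  kernel of the mixed Lefschetz operator, `rad(h_Θ) = {A ∈ Λ^{p,q} : Ω_Θ ∧ A = 0}`
  (`mem_radical_hrFormPQ_iff_wedge_eq_zero`, `radical_hrFormPQ_eq_primitiveReal`; `⇒` Poincaré duality on invariant
  forms, T2 `wedgeFamily_wedge_eq_zero_of_forall_torusIntegral_eq_zero`; `⇐` associativity); hence Sylvester's count
  `b⁺ + b⁻ + 2 dim_ℂ ker = 2 C(g,p) C(g,q)` (`sigPos_add_sigNeg_add_finrank_ker_hrFormPQ`) and
  **`h_Θ` non-degenerate ⟺ mixed hard Lefschetz for `Θ` on `Λ^{p,q}`** (`hrFormPQ_nondegenerate_iff_wedge_injective`: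
  the complement of Dinh–Nguyên's cone `L`);
* §3 along every PRECONNECTED set of real `J`-invariant backgrounds satisfying mixed hard Lefschetz the indices
  `(b⁺, b⁻)` are constant (`sigPos_sigNeg_hrFormPQ_eq_of_isPreconnected`; T1's local constancy of the signature of
  a continuous non-degenerate family) — "`K^{HR}` is a union of connected components of `K ∖ L`" — and equal to the
  Hodge–Riemann values of g25-#1 as soon as the set meets the positive cone
  (`sigPos_sigNeg_hrFormPQ_of_isPreconnected_of_mem_positiveTuples`);
* §4 in the CLOSURE of the positive cone (semi-positive `J`-invariant backgrounds, `θ_j(iv, v) ≥ 0`): mixed hard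
  Lefschetz forces the Hodge–Riemann count (`sigPos_sigNeg_hrFormPQ_of_semipos_of_wedge_injective`: the indices can
  only drop, g25-#1, and their sum is full), and — with mixed hard Lefschetz also for the background with the last form
  repeated, which gives the `h`-orthogonal mixed Lefschetz splitting of T2/T4a — **mixed Hodge–Riemann: `h` is
  positive definite on the mixed primitive forms** (`posDef_hrFormPQ_restrict_primitiveReal_of_semipos_of_wedge_injective`,
  bidegree `(p+1, q+1)`; `posDef_hrFormPQ_of_semipos_of_wedge_injective_of_fst_eq_zero_or_snd_eq_zero`, bidegrees
  `(p, 0)`, `(0, q)`).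

## Sources (held copies read; locators are arXiv PDF pages / chunks)

* T.-C. Dinh, V.-A. Nguyên, *The mixed Hodge–Riemann bilinear relations for compact Kähler manifolds*, GAFA 16
  (2006) 838–849 [DinhNguyen2006] (held `paper:arxiv-math_0501449`), p. 9 (chunk p0009 L49–L79): "Let `L_{n-2}` be
  the set of all classes `[Ω]` […] such that the wedge product map `[α] ↦ [α] ∧ [Ω]` does not induce an isomorphism
  between `H^{1,1}(X)` and `H^{n-1,n-1}(X)`. […] **Proposition 4.1.** The cone `K^{HR}_{n-2}` is a union of connected
  components of `K_{n-2} ∖ L_{n-2}`. In particular, it does not depend on the Kähler form `ω`. Moreover, if `[Ω]` is a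
  class in `K̄^{HR}_{n-2}` then `Q(·,·)` is positive semi-definite on `P^{1,1}(X)` and for `c ∈ P^{1,1}(X)` we have
  `Q(c,c) = 0` if and only if `c ∧ [Ω] = 0`. Proof. […] By continuity, `Q(·,·)` is positive semi-definite on
  `P^{1,1}(X)`. […] The Cauchy–Schwarz inequality implies that `Q(c, c') = 0` for every `c'` […] Consequently,
  `Q(c, ·) = 0`. Therefore, the Poincaré duality implies that `c ∧ [Ω] = 0`. Hence, `[Ω] ∈ L_{n-2}`." — and p. 5
  (chunk p0005) Prop. 2.1 (a)–(c).
* J. Gregory, *Quadratic Form Theory and Differential Equations* (1980) [Gregory1980QuadraticForms], Ch. 2 §2.2 Thm. 14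
  (Sylvester), §2.3 p. 83 (null space), Thm. 6 (5), Cor. 7 (6c), Cor. 8 (local constancy of the signature of a
  non-degenerate continuous family; chunks p0077–p0087) — through T1 `SignatureContinuousFamily`.
* C. Voisin, *Hodge Theory and Complex Algebraic Geometry I* (2002) [VoisinHodgeI2002], §6.3.2 proof of Thm. 6.33
  (non-degeneracy from hard Lefschetz and Poincaré duality), Thm. 6.32.
* E. Cattani, *Mixed Lefschetz theorems and Hodge–Riemann bilinear relations*, IMRN 2008 [Cattani2008MixedLefschetz],
  §2 Def. 2.1 (the Lefschetz property) / Thm. 2.2.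
* H. Lange, *Abelian Varieties over the Complex Numbers* (2023) [Lange2023AbelianVarietiesComplex], §6.2.4 (Poincaré
  duality on `H(X, ℂ)`), §1.1.5 Prop. 1.1.23; F. W. Warner, GTM 94, 2.6 [WarnerGTM94].

Scope: Dinh–Nguyên's `K_{n-2}` is the cone of ALL positive `(n-2, n-2)`-classes on a compact Kähler manifold; here the
backgrounds are monomials `θ_1 ∧ ⋯ ∧ θ_n` of real `(1,1)`-forms on a torus (the linear context), where the closure of
the cone of positive tuples is reached by `θ + cη → θ` (g25-#1 §5).
-/

noncomputable section

set_option maxSynthPendingDepth 3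

open scoped ComplexConjugate ComplexOrder
open Complex Function Module
open Literature.LinearAlgebra.Alternating
open Literature.Analysis.Complex (IsOfTypeAt typeSubmodule isOfTypeAt_of_mem_typeSubmodule)

namespace Literature.Geometry.Kaehler

namespace ComplexTorus

universe u

open Literature.LinearAlgebra.QuadraticForm

/-! ## §1 The radical of a symmetric real bilinear form -/

section Radical

variable {V : Type*} [AddCommGroup V] [Module ℝ V]

/-- For a SYMMETRIC real bilinear form, the radical of `x ↦ B(x, x)` is `{x : B(x, ·) = 0}` (the polar form is
`2B`). [cite: Gregory1980QuadraticForms, Ch. 2 §2.3 p. 83 (the null space `𝓑₀ = 𝓑 ∩ 𝓑^Q`; chunk p0083)] -/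
theorem mem_radical_toQuadraticMap_iff_of_isSymm {B : LinearMap.BilinForm ℝ V} (hB : B.IsSymm) (x : V) :
    x ∈ B.toQuadraticMap.radical ↔ ∀ y, B x y = 0 := by
  haveI : Invertible (2 : ℝ) := invertibleOfNonzero two_ne_zero
  rw [QuadraticMap.radical_eq_ker_polarBilin, LinearMap.mem_ker, LinearMap.BilinMap.polarBilin_toQuadraticMap]
  constructor
  · intro h y
    have h1 := LinearMap.congr_fun h y
    simp only [LinearMap.add_apply, LinearMap.flip_apply, LinearMap.zero_apply] at h1
    rw [hB.eq y x] at h1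
    linarith
  · intro h
    ext y
    simp only [LinearMap.add_apply, LinearMap.flip_apply, LinearMap.zero_apply]
    rw [h y, zero_add, hB.eq y x, h y]

/-- A symmetric real bilinear form is non-degenerate iff its quadratic form has trivial radical.
[cite: Gregory1980QuadraticForms, Ch. 2 §2.3 p. 83 (nullity; chunk p0083)] -/
theorem nondegenerate_iff_radical_eq_bot_of_isSymm {B : LinearMap.BilinForm ℝ V} (hB : B.IsSymm) :
    B.Nondegenerate ↔ B.toQuadraticMap.radical = ⊥ := by
  refine ⟨fun h ↦ radical_toQuadraticMap_eq_bot_of_nondegenerate hB.eq h, fun h ↦ ?_⟩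
  have hleft : ∀ x, (∀ y, B x y = 0) → x = 0 := fun x hx ↦ by
    have hm : x ∈ B.toQuadraticMap.radical := (mem_radical_toQuadraticMap_iff_of_isSymm hB x).2 hx
    rw [h] at hm
    exact (Submodule.mem_bot ℝ).1 hm
  exact ⟨fun x hx ↦ hleft x hx, fun y hy ↦ hleft y fun x ↦ by rw [hB.eq y x]; exact hy x⟩

end Radical

/-! ## §2 The radical of `h_Θ` on `Λ^{p,q}` is the kernel of `Ω_Θ ∧ ·` — for every real `(1,1)` background -/

section Kernel

variable {ι : Type*} [Fintype ι] [DecidableEq ι] {E : Type u} [NormedAddCommGroup E] [NormedSpace ℂ E]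
  (Φ : (ι → ℝ) ≃L[ℝ] E)

/-- **The kernel of the mixed Hodge–Riemann form is the kernel of the mixed Lefschetz operator — for EVERY real
background of type `(1,1)`, positive or not.** On the torus `X = E/Φ(ℤ^ι)` of dimension `g = n + p + q`, for complex
`2`-forms `θ_1, …, θ_n` of type `(1,1)` with `θ̄_j = θ_j`, `Ω = θ_1 ∧ ⋯ ∧ θ_n`, and a sign `ε ≠ 0` with
`conj ε = (-1)^k ε`: a form `A ∈ Λ^{p,q}` is in the radical of `h(A, B) = Re(ε ∫_X Ω ∧ A ∧ B̄)` on `Λ^{p,q}` iff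
`Ω ∧ A = 0` ("`Q(c, ·) = 0` … Therefore, the Poincaré duality implies that `c ∧ [Ω] = 0`", Dinh–Nguyên's proof of
Prop. 4.1; `⇐` is associativity). [cite: DinhNguyen2006, §4 Prop. 4.1 (proof) (arXiv PDF p. 9)]
[cite: VoisinHodgeI2002, §6.3.2 (proof of Thm. 6.33: non-degeneracy by Poincaré duality)] [cite: Lange2023AbelianVarietiesComplex, §6.2.4 (p. 310)] -/
theorem mem_radical_hrFormPQ_iff_wedge_eq_zero {g n k p q : ℕ} (e : Fin (2 * g) ≃ ι)
    {Θ : Fin n → E [⋀^Fin 2]→L[ℝ] ℂ} (hΘ : ∀ j, IsOfTypeAt 1 1 (Θ j)) (hΘr : ∀ j, conjForm (Θ j) = Θ j)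
    (hnk : n + k = g) (hpq : p + q = k) (h2 : 2 * n + (k + k) = 2 * g) {σ : ℂ} (hσ : conj σ = (-1) ^ k * σ)
    (hσ0 : σ ≠ 0) (A : ↥((typeSubmodule E k p q).restrictScalars ℝ)) :
    A ∈ (hrFormPQ Φ e σ (wedgeFamily n Θ) h2 p q).toQuadraticMap.radical ↔
      (wedgeFamily n Θ).wedge (A : E [⋀^Fin k]→L[ℝ] ℂ) = 0 := by
  rw [mem_radical_toQuadraticMap_iff_of_isSymm
    (hrFormPQ_isSymm Φ e σ _ h2 p q (conjForm_wedgeFamily_of_real hΘr) hσ)]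
  constructor
  · intro h
    exact wedgeFamily_wedge_eq_zero_of_forall_torusIntegral_eq_zero Φ e hΘ hnk hpq h2 A.2 fun B hB ↦
      torusIntegral_eq_zero_of_forall_hrForm_eq_zero Φ e σ _ h2 hσ0 (U := typeSubmodule E k p q)
        (fun B' hB' ↦ h ⟨B', hB'⟩) hB
  · intro h B
    rw [hrFormPQ_apply, hrPairing_apply,
      (domDomCongr_finCongr_eq_zero_iff _).2 (wedge_wedge_eq_zero_of_wedge_eq_zero h _), torusIntegral_zero,
      mul_zero, Complex.zero_re]

/-- **The radical as a subspace: `rad(h_Θ|Λ^{p,q}) = ker(Ω_Θ ∧ ·) ∩ Λ^{p,q}`** (T4a's `primitiveReal Θ k p q` read for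
the background `Θ` itself), for every real `(1,1)` background. [cite: DinhNguyen2006, §4 Prop. 4.1 (proof) (arXiv PDF p. 9)]
[cite: VoisinHodgeI2002, §6.3.2 (proof of Thm. 6.33)] -/
theorem radical_hrFormPQ_eq_primitiveReal {g n k p q : ℕ} (e : Fin (2 * g) ≃ ι)
    {Θ : Fin n → E [⋀^Fin 2]→L[ℝ] ℂ} (hΘ : ∀ j, IsOfTypeAt 1 1 (Θ j)) (hΘr : ∀ j, conjForm (Θ j) = Θ j)
    (hnk : n + k = g) (hpq : p + q = k) (h2 : 2 * n + (k + k) = 2 * g) {σ : ℂ} (hσ : conj σ = (-1) ^ k * σ)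
    (hσ0 : σ ≠ 0) :
    (hrFormPQ Φ e σ (wedgeFamily n Θ) h2 p q).toQuadraticMap.radical = primitiveReal Θ k p q := by
  ext A
  rw [mem_radical_hrFormPQ_iff_wedge_eq_zero Φ e hΘ hΘr hnk hpq h2 hσ hσ0, mem_primitiveReal]

/-- **Sylvester's count for an arbitrary real `(1,1)` background**: on `Λ^{p,q}`,
`b⁺(h_Θ) + b⁻(h_Θ) + 2 dim_ℂ (ker(Ω_Θ ∧ ·) ∩ Λ^{p,q}) = 2 C(g,p) C(g,q)`.
[cite: Gregory1980QuadraticForms, Ch. 2 §2.2 Thm. 14 (chunk p0078)] [cite: DinhNguyen2006, §4 Prop. 4.1 (arXiv PDF p. 9)]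
[cite: Lange2023AbelianVarietiesComplex, §1.1.5 Prop. 1.1.23] -/
theorem sigPos_add_sigNeg_add_finrank_ker_hrFormPQ {g n k p q : ℕ} (e : Fin (2 * g) ≃ ι)
    {Θ : Fin n → E [⋀^Fin 2]→L[ℝ] ℂ} (hΘ : ∀ j, IsOfTypeAt 1 1 (Θ j)) (hΘr : ∀ j, conjForm (Θ j) = Θ j)
    (hnk : n + k = g) (hpq : p + q = k) (h2 : 2 * n + (k + k) = 2 * g) {σ : ℂ} (hσ : conj σ = (-1) ^ k * σ)
    (hσ0 : σ ≠ 0) :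
    sigPos (hrFormPQ Φ e σ (wedgeFamily n Θ) h2 p q).toQuadraticMap +
        sigNeg (hrFormPQ Φ e σ (wedgeFamily n Θ) h2 p q).toQuadraticMap +
        2 * finrank ℂ ↥(mixedPrimitiveForms Θ k ⊓ typeSubmodule E k p q) = 2 * (g.choose p * g.choose q) := by
  haveI := finiteDimensional_complex Φ
  haveI : FiniteDimensional ℝ (E [⋀^Fin k]→L[ℝ] ℂ) := finiteDimensional_real_complexForms
  have hg : finrank ℂ E = g := finrank_eq_of_finTwoMulEquiv Φ e
  have h := QuadraticForm.sigPos_add_sigNeg_add_radical (Q := (hrFormPQ Φ e σ (wedgeFamily n Θ) h2 p q).toQuadraticMap)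
  rwa [radical_hrFormPQ_eq_primitiveReal Φ e hΘ hΘr hnk hpq h2 hσ hσ0, finrank_primitiveReal_eq,
    finrank_typeSubmodule_real hg hpq] at h

/-- **Non-degenerate ⟺ mixed hard Lefschetz** for an arbitrary real `(1,1)` background: `h_Θ` is non-degenerate
on `Λ^{p,q}` iff `Ω_Θ ∧ ·` is injective on `Λ^{p,q}` (Dinh–Nguyên: the Hodge–Riemann cone avoids exactly the
algebraic cone `L` where "the wedge product map `[α] ↦ [α] ∧ [Ω]` does not induce an isomorphism").
[cite: DinhNguyen2006, §4 Prop. 4.1 and the definition of `L_{n-2}` (arXiv PDF p. 9)] [cite: Cattani2008MixedLefschetz, §2 Def. 2.1] -/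
theorem hrFormPQ_nondegenerate_iff_wedge_injective {g n k p q : ℕ} (e : Fin (2 * g) ≃ ι)
    {Θ : Fin n → E [⋀^Fin 2]→L[ℝ] ℂ} (hΘ : ∀ j, IsOfTypeAt 1 1 (Θ j)) (hΘr : ∀ j, conjForm (Θ j) = Θ j)
    (hnk : n + k = g) (hpq : p + q = k) (h2 : 2 * n + (k + k) = 2 * g) {σ : ℂ} (hσ : conj σ = (-1) ^ k * σ)
    (hσ0 : σ ≠ 0) :
    (hrFormPQ Φ e σ (wedgeFamily n Θ) h2 p q).Nondegenerate ↔
      ∀ A ∈ typeSubmodule E k p q, (wedgeFamily n Θ).wedge A = 0 → A = 0 := by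
  rw [nondegenerate_iff_radical_eq_bot_of_isSymm
    (hrFormPQ_isSymm Φ e σ _ h2 p q (conjForm_wedgeFamily_of_real hΘr) hσ), Submodule.eq_bot_iff]
  constructor
  · intro h A hA h0
    have h1 := h ⟨A, hA⟩ ((mem_radical_hrFormPQ_iff_wedge_eq_zero Φ e hΘ hΘr hnk hpq h2 hσ hσ0 _).2 h0)
    exact congrArg Subtype.val h1
  · intro h A hA
    exact Subtype.ext (h A A.2 ((mem_radical_hrFormPQ_iff_wedge_eq_zero Φ e hΘ hΘr hnk hpq h2 hσ hσ0 _).1 hA))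

/-- The radical form: `rad(h_Θ) = ⊥ ⟺` mixed hard Lefschetz for `Θ` on `Λ^{p,q}`.
[cite: DinhNguyen2006, §4 Prop. 4.1 (arXiv PDF p. 9)] -/
theorem radical_hrFormPQ_eq_bot_iff_wedge_injective {g n k p q : ℕ} (e : Fin (2 * g) ≃ ι)
    {Θ : Fin n → E [⋀^Fin 2]→L[ℝ] ℂ} (hΘ : ∀ j, IsOfTypeAt 1 1 (Θ j)) (hΘr : ∀ j, conjForm (Θ j) = Θ j)
    (hnk : n + k = g) (hpq : p + q = k) (h2 : 2 * n + (k + k) = 2 * g) {σ : ℂ} (hσ : conj σ = (-1) ^ k * σ)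
    (hσ0 : σ ≠ 0) :
    (hrFormPQ Φ e σ (wedgeFamily n Θ) h2 p q).toQuadraticMap.radical = ⊥ ↔
      ∀ A ∈ typeSubmodule E k p q, (wedgeFamily n Θ).wedge A = 0 → A = 0 := by
  rw [← nondegenerate_iff_radical_eq_bot_of_isSymm
    (hrFormPQ_isSymm Φ e σ _ h2 p q (conjForm_wedgeFamily_of_real hΘr) hσ)]
  exact hrFormPQ_nondegenerate_iff_wedge_injective Φ e hΘ hΘr hnk hpq h2 hσ hσ0

end Kernel

/-! ## §3 The Hodge–Riemann cone is a union of connected components of the mixed-hard-Lefschetz locus: along a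
preconnected family of backgrounds satisfying mixed hard Lefschetz the indices are constant -/

section Components

variable {ι : Type*} [Fintype ι] [DecidableEq ι] {E : Type u} [NormedAddCommGroup E] [NormedSpace ℂ E]
  (Φ : (ι → ℝ) ≃L[ℝ] E)

/-- **The indices of `h_θ` on `Λ^{p,q}` are constant along every PRECONNECTED set `S` of real `J`-invariant
backgrounds `θ = (θ_1, …, θ_n)` all of which satisfy mixed hard Lefschetz on `Λ^{p,q}`** (no positivity assumed):
the family is continuous in `θ` (T4a), non-degenerate on `S` by §2, and a continuous non-degenerate family of quadratic
forms has locally constant signature (T1, Gregory's Cor. 7). This is the mechanism of Dinh–Nguyên's Prop. 4.1: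
"`K^{HR}_{n-2}` is a union of connected components of `K_{n-2} ∖ L_{n-2}`". [cite: DinhNguyen2006, §4 Prop. 4.1 (arXiv PDF p. 9)]
[cite: Gregory1980QuadraticForms, Ch. 2 §2.3 Cor. 7 (6c), Cor. 8 (chunk p0087)] -/
theorem sigPos_sigNeg_hrFormPQ_eq_of_isPreconnected {g n k p q : ℕ} (e : Fin (2 * g) ≃ ι) (hnk : n + k = g)
    (hpq : p + q = k) (h2 : 2 * n + (k + k) = 2 * g) {S : Set (Fin n → E [⋀^Fin 2]→L[ℝ] ℝ)} (hS : IsPreconnected S)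
    (h11 : ∀ s ∈ S, ∀ j (x y : E), s j ![I • x, I • y] = s j ![x, y])
    (hHL : ∀ s ∈ S, ∀ A ∈ typeSubmodule E k p q, (wedgeFamily n fun j ↦ ofRealForm (-(s j))).wedge A = 0 → A = 0)
    {s t : Fin n → E [⋀^Fin 2]→L[ℝ] ℝ} (hs : s ∈ S) (ht : t ∈ S) :
    sigPos (hrFormPQ Φ e (hrSign k p q) (wedgeFamily n fun j ↦ ofRealForm (-(s j))) h2 p q).toQuadraticMap =
        sigPos (hrFormPQ Φ e (hrSign k p q) (wedgeFamily n fun j ↦ ofRealForm (-(t j))) h2 p q).toQuadraticMap ∧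
      sigNeg (hrFormPQ Φ e (hrSign k p q) (wedgeFamily n fun j ↦ ofRealForm (-(s j))) h2 p q).toQuadraticMap =
        sigNeg (hrFormPQ Φ e (hrSign k p q) (wedgeFamily n fun j ↦ ofRealForm (-(t j))) h2 p q).toQuadraticMap := by
  haveI := finiteDimensional_complex Φ
  haveI : FiniteDimensional ℝ (E [⋀^Fin k]→L[ℝ] ℂ) := finiteDimensional_real_complexForms
  set B : (Fin n → E [⋀^Fin 2]→L[ℝ] ℝ) → LinearMap.BilinForm ℝ ↥((typeSubmodule E k p q).restrictScalars ℝ) :=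
    fun r ↦ hrFormPQ Φ e (hrSign k p q) (wedgeFamily n fun j ↦ ofRealForm (-(r j))) h2 p q with hB
  have hcont : ∀ x y : ↥((typeSubmodule E k p q).restrictScalars ℝ), ContinuousOn (fun r ↦ B r x y) S := by
    intro x y
    have h := continuous_hrForm_wedgeFamily Φ e (hrSign k p q) h2 (θ := fun (r : Fin n → E [⋀^Fin 2]→L[ℝ] ℝ) j ↦ r j)
      (fun j ↦ continuous_apply j) (x : E [⋀^Fin k]→L[ℝ] ℂ) (y : E [⋀^Fin k]→L[ℝ] ℂ)
    simp only [hrForm_apply] at h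
    simp only [hB, hrFormPQ_apply]
    exact h.continuousOn
  have hrad : ∀ r ∈ S, (B r).toQuadraticMap.radical = ⊥ := fun r hr ↦
    (radical_hrFormPQ_eq_bot_iff_wedge_injective Φ e (isOfTypeAt_ofRealForm_neg_family (h11 r hr))
      (conjForm_ofRealForm_neg_family r) hnk hpq h2 (conj_hrSign hpq) (hrSign_ne_zero k p q)).2 (hHL r hr)
  exact ⟨sigPos_eq_of_isPreconnected B hS hcont hrad hs ht, sigNeg_eq_of_isPreconnected B hS hcont hrad hs ht⟩

/-- **A preconnected family of mixed-hard-Lefschetz backgrounds that meets the positive cone is Hodge–Riemann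
throughout**: its indices are the Hodge–Riemann values of g25-#1
(`b⁺ = 2 Σ_{j ≤ min(p,q)} (-1)^j C(g,p-j) C(g,q-j)`, `b⁻ = 2 Σ_{j < min(p,q)} (-1)^j C(g,p-1-j) C(g,q-1-j)`) at every
member ("one of the connected components of `K^{HR}` contains all the products of Kähler classes").
[cite: DinhNguyen2006, §4 Prop. 4.1 and the paragraph before it (arXiv PDF p. 9)] [cite: VoisinHodgeI2002, §6.3.2 Thm. 6.33] -/
theorem sigPos_sigNeg_hrFormPQ_of_isPreconnected_of_mem_positiveTuples {g n k p q : ℕ} (e : Fin (2 * g) ≃ ι)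
    (hnk : n + k = g) (hpq : p + q = k) (h2 : 2 * n + (k + k) = 2 * g) {S : Set (Fin n → E [⋀^Fin 2]→L[ℝ] ℝ)}
    (hS : IsPreconnected S) (h11 : ∀ s ∈ S, ∀ j (x y : E), s j ![I • x, I • y] = s j ![x, y])
    (hHL : ∀ s ∈ S, ∀ A ∈ typeSubmodule E k p q, (wedgeFamily n fun j ↦ ofRealForm (-(s j))).wedge A = 0 → A = 0)
    {t₀ s : Fin n → E [⋀^Fin 2]→L[ℝ] ℝ} (ht₀ : t₀ ∈ S) (ht₀p : t₀ ∈ positiveTuples E n) (hs : s ∈ S) :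
    ((sigPos (hrFormPQ Φ e (hrSign k p q) (wedgeFamily n fun j ↦ ofRealForm (-(s j))) h2 p q).toQuadraticMap : ℕ) : ℤ) =
        2 * ∑ j ∈ Finset.range (min p q + 1), (-1) ^ j * ((g.choose (p - j) * g.choose (q - j) : ℕ) : ℤ) ∧
      ((sigNeg (hrFormPQ Φ e (hrSign k p q) (wedgeFamily n fun j ↦ ofRealForm (-(s j))) h2 p q).toQuadraticMap : ℕ) : ℤ) =
        2 * ∑ j ∈ Finset.range (min p q), (-1) ^ j * ((g.choose (p - 1 - j) * g.choose (q - 1 - j) : ℕ) : ℤ) := by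
  obtain ⟨hP, hM⟩ := sigPos_sigNeg_hrFormPQ_eq_of_isPreconnected Φ e hnk hpq h2 hS h11 hHL hs ht₀
  obtain ⟨hP₀, hM₀⟩ := sigPos_sigNeg_hrFormPQ_of_pos Φ e hnk hpq h2 ht₀p
  rw [hP, hM]
  exact ⟨hP₀, hM₀⟩

end Components

/-! ## §4 In the closure of the cone: for a semi-positive background, mixed hard Lefschetz forces the Hodge–Riemann
count, and mixed Hodge–Riemann on the mixed primitive forms -/

section Semipositive

variable {ι : Type*} [Fintype ι] [DecidableEq ι] {E : Type u} [NormedAddCommGroup E] [NormedSpace ℂ E]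
  (Φ : (ι → ℝ) ≃L[ℝ] E)

/-- **Semi-positive background + mixed hard Lefschetz ⇒ the Hodge–Riemann count.** For a semi-positive
`J`-invariant background `θ` (`θ_j(iv, v) ≥ 0`) on `Λ^{p,q}` satisfying mixed hard Lefschetz, the indices of
`h_θ` are the Hodge–Riemann values: they can only drop in the closure of the cone (g25-#1) while their sum stays
`2 C(g,p) C(g,q)` (non-degeneracy, §2). [cite: DinhNguyen2006, §4 Prop. 4.1 (arXiv PDF p. 9)]
[cite: Gregory1980QuadraticForms, Ch. 2 §2.3 Thm. 6 (5) and Cor. 7 (chunk p0087)] -/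
theorem sigPos_sigNeg_hrFormPQ_of_semipos_of_wedge_injective {g n k p q : ℕ} (e : Fin (2 * g) ≃ ι)
    (hnk : n + k = g) (hpq : p + q = k) (h2 : 2 * n + (k + k) = 2 * g) {s t : Fin n → E [⋀^Fin 2]→L[ℝ] ℝ}
    (h11 : ∀ j (x y : E), s j ![I • x, I • y] = s j ![x, y]) (hpsd : ∀ j (v : E), 0 ≤ s j ![I • v, v])
    (hHL : ∀ A ∈ typeSubmodule E k p q, (wedgeFamily n fun j ↦ ofRealForm (-(s j))).wedge A = 0 → A = 0)
    (ht : t ∈ positiveTuples E n) :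
    sigPos (hrFormPQ Φ e (hrSign k p q) (wedgeFamily n fun j ↦ ofRealForm (-(s j))) h2 p q).toQuadraticMap =
        sigPos (hrFormPQ Φ e (hrSign k p q) (wedgeFamily n fun j ↦ ofRealForm (-(t j))) h2 p q).toQuadraticMap ∧
      sigNeg (hrFormPQ Φ e (hrSign k p q) (wedgeFamily n fun j ↦ ofRealForm (-(s j))) h2 p q).toQuadraticMap =
        sigNeg (hrFormPQ Φ e (hrSign k p q) (wedgeFamily n fun j ↦ ofRealForm (-(t j))) h2 p q).toQuadraticMap :=
  (radical_hrFormPQ_eq_bot_iff_of_semipos Φ e hnk hpq h2 h11 hpsd ht).1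
    ((radical_hrFormPQ_eq_bot_iff_wedge_injective Φ e (isOfTypeAt_ofRealForm_neg_family h11)
      (conjForm_ofRealForm_neg_family s) hnk hpq h2 (conj_hrSign hpq) (hrSign_ne_zero k p q)).2 hHL)

omit [Fintype ι] [DecidableEq ι] in
/-- The repeated-last-form tuple inherits `J`-invariance. [folklore] -/
private theorem h11_snoc' {n : ℕ} {t : Fin (n + 1) → E [⋀^Fin 2]→L[ℝ] ℝ}
    (h11 : ∀ j (x y : E), t j ![I • x, I • y] = t j ![x, y]) (j : Fin (n + 2)) (x y : E) :
    Fin.snoc (α := fun _ ↦ E [⋀^Fin 2]→L[ℝ] ℝ) t (t (Fin.last n)) j ![I • x, I • y] =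
      Fin.snoc (α := fun _ ↦ E [⋀^Fin 2]→L[ℝ] ℝ) t (t (Fin.last n)) j ![x, y] := by
  refine Fin.lastCases ?_ (fun i ↦ ?_) j
  · simp only [Fin.snoc_last, h11]
  · simp only [Fin.snoc_castSucc, h11]

omit [Fintype ι] [DecidableEq ι] in
/-- The repeated-last-form tuple inherits semi-positivity. [folklore] -/
private theorem hpsd_snoc' {n : ℕ} {t : Fin (n + 1) → E [⋀^Fin 2]→L[ℝ] ℝ}
    (hpsd : ∀ j (v : E), 0 ≤ t j ![I • v, v]) (j : Fin (n + 2)) (v : E) :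
    0 ≤ Fin.snoc (α := fun _ ↦ E [⋀^Fin 2]→L[ℝ] ℝ) t (t (Fin.last n)) j ![I • v, v] := by
  refine Fin.lastCases ?_ (fun i ↦ ?_) j
  · simp only [Fin.snoc_last]; exact hpsd _ v
  · simp only [Fin.snoc_castSucc]; exact hpsd _ v

/-- **In the closure of the cone, mixed hard Lefschetz implies mixed Hodge–Riemann** (bidegree `(p+1, q+1)`): for a
SEMI-positive `J`-invariant background `θ_0, …, θ_n` on the torus `X` of dimension `g = n + p + q + 2` such that
mixed hard Lefschetz holds for `(θ_0, …, θ_{n-1})` on `Λ^{p+1,q+1}` and for `(θ_0, …, θ_n, θ_n)` on `Λ^{p,q}`, the form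
`h = Re(ε ∫_X (-θ_0)_ℂ ∧ ⋯ ∧ (-θ_{n-1})_ℂ ∧ A ∧ B̄)` is POSITIVE DEFINITE on the mixed primitive forms
`{A ∈ Λ^{p+1,q+1} : (-θ_0)_ℂ ∧ ⋯ ∧ (-θ_n)_ℂ ∧ A = 0}`: the two forms are non-degenerate (§2), their indices are
the Hodge–Riemann values (`sigPos_sigNeg_hrFormPQ_of_semipos_of_wedge_injective`), and the `h`-orthogonal splitting
`Λ^{p+1,q+1} = P ⊕ ω ∧ Λ^{p,q}` (T4a) leaves `b⁺(h|_P) = dim P`. This is the torus form of "if `[Ω] ∈ K̄^{HR}` […]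
`Q` is positive semi-definite on `P^{1,1}` and […] `Q(c,c) = 0` iff `c ∧ [Ω] = 0`" sharpened by mixed hard Lefschetz,
in every bidegree. [cite: DinhNguyen2006, §4 Prop. 4.1 (arXiv PDF p. 9)] [cite: DinhNguyen2006, §2 Prop. 2.1 (b), (c) (arXiv PDF p. 5)]
[cite: Gregory1980QuadraticForms, Ch. 2 §2.3 Cor. 7 (chunk p0087)] -/
theorem posDef_hrFormPQ_restrict_primitiveReal_of_semipos_of_wedge_injective {g n m p q : ℕ} (e : Fin (2 * g) ≃ ι)
    (hpq : p + q = m) (hnk : n + (m + 2) = g) (h2 : 2 * n + ((m + 2) + (m + 2)) = 2 * g)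
    {t : Fin (n + 1) → E [⋀^Fin 2]→L[ℝ] ℝ} (h11 : ∀ j (x y : E), t j ![I • x, I • y] = t j ![x, y])
    (hpsd : ∀ j (v : E), 0 ≤ t j ![I • v, v])
    (hHL₁ : ∀ A ∈ typeSubmodule E (m + 2) (p + 1) (q + 1),
      (wedgeFamily n (Fin.init fun j ↦ ofRealForm (-(t j)))).wedge A = 0 → A = 0)
    (hHL₂ : ∀ C ∈ typeSubmodule E m p q,
      (wedgeFamily (n + 2) (Fin.snoc (α := fun _ ↦ E [⋀^Fin 2]→L[ℝ] ℂ) (fun j ↦ ofRealForm (-(t j)))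
        (ofRealForm (-(t (Fin.last n)))))).wedge C = 0 → C = 0) :
    ((hrFormPQ Φ e (hrSign (m + 2) (p + 1) (q + 1)) (wedgeFamily n (Fin.init fun j ↦ ofRealForm (-(t j)))) h2
        (p + 1) (q + 1)).toQuadraticMap.restrict (primitiveReal (fun j ↦ ofRealForm (-(t j))) (m + 2) (p + 1) (q + 1))).PosDef := by
  haveI := finiteDimensional_complex Φ
  haveI : FiniteDimensional ℝ (E [⋀^Fin (m + 2)]→L[ℝ] ℂ) := finiteDimensional_real_complexForms
  subst hnk
  have hg : finrank ℂ E = n + (m + 2) := finrank_eq_of_finTwoMulEquiv Φ e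
  have h2' : 2 * (n + 2) + (m + m) = 2 * (n + (m + 2)) := by omega
  have hσ : conj (hrSign (m + 2) (p + 1) (q + 1)) = (-1) ^ (m + 2) * hrSign (m + 2) (p + 1) (q + 1) :=
    conj_hrSign (by omega)
  have hσ0 := hrSign_ne_zero (m + 2) (p + 1) (q + 1)
  have hΘ : ∀ j, IsOfTypeAt 1 1 ((fun j ↦ ofRealForm (-(t j))) j) := isOfTypeAt_ofRealForm_neg_family h11
  have hΘr : ∀ j, conjForm ((fun j ↦ ofRealForm (-(t j))) j) = (fun j ↦ ofRealForm (-(t j))) j :=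
    conjForm_ofRealForm_neg_family t
  -- a positive comparison background
  obtain ⟨t₀, ht₀⟩ := positiveTuples_nonempty Φ (E := E) (n + 1)
  -- (1) the indices of `h^{(p+1,q+1)}` at `t` are those at `t₀`
  have hHL₁' : ∀ A ∈ typeSubmodule E (m + 2) (p + 1) (q + 1),
      (wedgeFamily n fun j ↦ ofRealForm (-(t (Fin.castSucc j)))).wedge A = 0 → A = 0 := hHL₁
  have hi₁ := sigPos_sigNeg_hrFormPQ_of_semipos_of_wedge_injective Φ e (rfl : n + (m + 2) = n + (m + 2))
    (show (p + 1) + (q + 1) = m + 2 by omega) h2 (s := fun j ↦ t (Fin.castSucc j)) (fun j ↦ h11 _) (fun j ↦ hpsd _)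
    hHL₁' (castSucc_mem_positiveTuples ht₀)
  -- (2) the indices of `h^{(p,q)}` for the background with the last form repeated are those at `t₀`
  have hHL₂' : ∀ C ∈ typeSubmodule E m p q, (wedgeFamily (n + 2) fun j ↦ ofRealForm
      (-(Fin.snoc (α := fun _ ↦ E [⋀^Fin 2]→L[ℝ] ℝ) t (t (Fin.last n)) j))).wedge C = 0 → C = 0 := by
    intro C hC h0
    rw [ofRealForm_neg_snoc] at h0
    exact hHL₂ C hC h0
  have hi₂ := sigPos_sigNeg_hrFormPQ_of_semipos_of_wedge_injective Φ e (show (n + 2) + m = n + (m + 2) by omega)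
    hpq h2' (s := Fin.snoc (α := fun _ ↦ E [⋀^Fin 2]→L[ℝ] ℝ) t (t (Fin.last n))) (h11_snoc' h11) (hpsd_snoc' hpsd)
    hHL₂' (snoc_mem_positiveTuples ht₀)
  -- (3) the recursion at the positive point `t₀`
  have hrec := sigPos_sigNeg_hrFormPQ_succ_succ_of_pos' Φ e hpq rfl h2 h2' ht₀
  -- (4) the `h`-orthogonal splitting at `t`
  have h1 := sigPos_sigNeg_hrFormPQ_eq_add Φ hg hpq rfl e hσ hσ0 hΘ hΘr h2 hHL₁ hHL₂
  have h3 := sigPos_sigNeg_restrict_lefschetzReal_eq Φ e (hrSign (m + 2) (p + 1) (q + 1)) hpq hΘ (hΘr (Fin.last n))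
    h2 h2' hHL₂
  have h4 : sigPos (hrFormPQ Φ e (hrSign (m + 2) (p + 1) (q + 1)) (wedgeFamily (n + 2)
      (Fin.snoc (α := fun _ ↦ E [⋀^Fin 2]→L[ℝ] ℂ) (fun j ↦ ofRealForm (-(t j))) (ofRealForm (-(t (Fin.last n))))))
        h2' p q).toQuadraticMap =
      sigNeg (hrFormPQ Φ e (hrSign m p q) (wedgeFamily (n + 2) fun j ↦ ofRealForm
        (-(Fin.snoc (α := fun _ ↦ E [⋀^Fin 2]→L[ℝ] ℝ) t (t (Fin.last n)) j))) h2' p q).toQuadraticMap := by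
    rw [hrSign_succ_succ, hrFormPQ_toQuadraticMap_neg_sign, sigPos_neg, ofRealForm_neg_snoc]
  have hdim := finrank_primitiveReal_succ_succ hg hpq rfl hΘ hHL₂
  -- the castSucc / init forms agree
  have e₁ : sigPos (hrFormPQ Φ e (hrSign (m + 2) (p + 1) (q + 1))
      (wedgeFamily n fun j ↦ ofRealForm (-(t (Fin.castSucc j)))) h2 (p + 1) (q + 1)).toQuadraticMap =
      sigPos (hrFormPQ Φ e (hrSign (m + 2) (p + 1) (q + 1)) (wedgeFamily n (Fin.init fun j ↦ ofRealForm (-(t j)))) h2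
        (p + 1) (q + 1)).toQuadraticMap := rfl
  refine posDef_of_finrank_le_sigPos (le_of_eq ?_)
  rw [hdim]
  omega

/-- **Bidegrees `(p, 0)` and `(0, q)` in the closure of the cone**: for a semi-positive `J`-invariant background
`θ_1, …, θ_n` satisfying mixed hard Lefschetz on `Λ^{p,q}`, `p = 0` or `q = 0`, the form `h_θ` is POSITIVE DEFINITE
on all of `Λ^{p,q}` (every form is primitive there). [cite: DinhNguyen2006, §4 Prop. 4.1 and §2 Prop. 2.1 (b) (arXiv PDF pp. 5, 9)] -/
theorem posDef_hrFormPQ_of_semipos_of_wedge_injective_of_fst_eq_zero_or_snd_eq_zero {g n k p q : ℕ}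
    (e : Fin (2 * g) ≃ ι) (hnk : n + k = g) (hpq : p + q = k) (h0 : p = 0 ∨ q = 0) (h2 : 2 * n + (k + k) = 2 * g)
    {s : Fin n → E [⋀^Fin 2]→L[ℝ] ℝ} (h11 : ∀ j (x y : E), s j ![I • x, I • y] = s j ![x, y])
    (hpsd : ∀ j (v : E), 0 ≤ s j ![I • v, v])
    (hHL : ∀ A ∈ typeSubmodule E k p q, (wedgeFamily n fun j ↦ ofRealForm (-(s j))).wedge A = 0 → A = 0) :
    (hrFormPQ Φ e (hrSign k p q) (wedgeFamily n fun j ↦ ofRealForm (-(s j))) h2 p q).toQuadraticMap.PosDef := by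
  haveI := finiteDimensional_complex Φ
  haveI : FiniteDimensional ℝ (E [⋀^Fin k]→L[ℝ] ℂ) := finiteDimensional_real_complexForms
  have hg : finrank ℂ E = g := finrank_eq_of_finTwoMulEquiv Φ e
  obtain ⟨t₀, ht₀⟩ := positiveTuples_nonempty Φ (E := E) n
  obtain ⟨hP, -⟩ := sigPos_sigNeg_hrFormPQ_of_semipos_of_wedge_injective Φ e hnk hpq h2 h11 hpsd hHL ht₀
  obtain ⟨hP₀, -⟩ := sigPos_sigNeg_hrFormPQ_of_pos_of_fst_eq_zero_or_snd_eq_zero Φ e hnk hpq h0 h2 ht₀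
  refine posDef_of_finrank_le_sigPos (le_of_eq ?_)
  rw [hP, hP₀, finrank_typeSubmodule_real hg hpq]

end Semipositive

end ComplexTorus

end Literature.Geometry.Kaehler

end
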